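import Summits.AtomisticToContinuum.Crystallization.Theorems.FreeSplittingCertificatesStrictSplittingRuleP1DemandBare

/-!
# `StrictSplittingRule` (stmt-AtomisticToContinuum-12560): LINEAR PRECISION of the P1 interpolant — barycentric reproduction on every cell, affine fields are reproduced, `p1Disp = p1Field ∘ samples` (P1 interpolant object, part 30)

Route `FreeSplittingCertificates`, crux r3 `StrictSplittingRule` (H12⋆ = `stub_coreJointCoercive`), unit b2b-freesplit-B gen 24.
VALUE = the glue between the two halves of the transfer (HOME FAR-LEMMA-SPEC §17 (d)/(e)): the far inequality and the receipts
transfer (parts 8, 16–23) are stated for the far-ledger field `v = p1Disp a h U b₀ A = p1Field U − (b₀ + y·A)`, while the demand-side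
lemmas (parts 24–29: vertex quadrature, Jensen, `tsum_p1SiteBare_le…`) are stated for `p1Field a h V` of lattice VALUES `V`.  Here:
* `sum_p1Bary_mul_p1Vec_vertOff` — the reference pieces' barycentric coordinates reproduce the chart coordinates (table identity);
* **`sum_p1Lam_mul_hcpSite`** — on every real cell `Σ_m λ_m(y)·y_m = y` (the chart is slab-wise affine and the cell lies in one slab);
* `sum_p1Lam_mul_norm_sub_sq` — the centred second-moment identity `Σ_m λ_m(y)|y_m − y|² = Σ_m λ_m(y)|y_m − c|² − |y − c|²` (any `c`),
  the pointwise engine of the circumradius form of the vertex-quadrature defect (next part);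
* **`p1Field_affine`** — affine fields are reproduced: `p1Field (n ↦ b₀ + y_n·A) = (y ↦ b₀ + y·A)`;
* `p1Field_sub` and **`p1Disp_eq_p1Field`** — `p1Disp a h U b₀ A = p1Field a h (n ↦ p1DispSite a h U b₀ A n)`: the far-ledger field IS
  the interpolant of its own lattice samples `p1DispSite` (part 11), so every `p1Field`-lemma applies to it with `V = p1DispSite`.
NOT a proof of H12⋆, NOT summit progress.  [folklore]
-/

noncomputable section

open Set Function Metric MeasureTheory Filter Topology
open scoped BigOperators

namespace Summit.AtomisticToContinuum.Crystallization.Theorems.StrictSplittingRuleBirth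

open Literature.MathematicalPhysics.StatisticalMechanics
open Summit.AtomisticToContinuum.Crystallization.Theorems.PalmUnimodularRigidity.LayeredLawsSelectHcp

/-! ## Barycentric reproduction in chart coordinates (table identity) -/

/-- **The barycentric coordinates of every reference piece reproduce the coordinates**: `Σ_m λ_m(p)·(v_m)_j = p_j`. -/
theorem sum_p1Bary_mul_p1Vec_vertOff (e : Bool) (π : Fin 6) (p : Fin 3 → ℝ) (j : Fin 3) :
    ∑ m : Fin 4, p1Bary e π m p * p1Vec (p1VertOff e π m) j = p j := by
  fin_cases e <;> fin_cases π <;> fin_cases j <;>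
    simp [Fin.sum_univ_four, p1Bary, p1BaryCoef, p1VertOff, p1Vec] <;> ring

/-- The layer offset of a vertex is `0` or `1` (as a real number). -/
theorem p1Vec_vertOff_zero_mem (e : Bool) (π : Fin 6) (m : Fin 4) :
    p1Vec (p1VertOff e π m) 0 = 0 ∨ p1Vec (p1VertOff e π m) 0 = 1 := by
  rcases (p1VertOff_mem e π m).1 with h | h
  · left; simp [p1Vec_zero, h]
  · right; simp [p1Vec_zero, h]

/-- The tent at an integer-plus-corner layer: `tent(k + s) = ℓ_k + ε_k·s` for `s ∈ {0, 1}`. -/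
theorem p1Tent_int_add_corner (k : ℤ) {s : ℝ} (hs : s = 0 ∨ s = 1) :
    p1Tent ((k : ℝ) + s) = (if Even k then 0 else 1) + (if Even k then 1 else -1) * s := by
  have h0 : (k : ℝ) ≤ k + s := by rcases hs with rfl | rfl <;> simp
  have h1 : (k : ℝ) + s ≤ k + 1 := by rcases hs with rfl | rfl <;> simp
  rw [p1Tent_slab k h0 h1]
  ring

/-! ## Barycentric reproduction on the real cells -/

/-- **`Σ_m λ_m(y)·y_m = y` on every real cell** (`y_m = hcpSite` of vertex `m` of the cell `i = (n, π)`): the P1 hat functions of a cell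
reproduce the identity map.  Proof: in chart coordinates this is the table identity `sum_p1Bary_mul_p1Vec_vertOff`; the chart is affine
on the slab `[n.1, n.1 + 1]` containing the cell and its vertices (`p1Tent_slab`). -/
theorem sum_p1Lam_mul_hcpSite {a h : ℝ} (ha : a ≠ 0) (hh : h ≠ 0) {i : (ℤ × ℤ × ℤ) × Fin 6} {y : Fin 3 → ℝ}
    (hy : y ∈ p1RealCell a h i) (k : Fin 3) :
    ∑ m : Fin 4, p1Lam a h i m y * hcpSite a h (i.1 + p1VertOff (p1Par i.1) i.2 m) k = y k := by
  set q : Fin 3 → ℝ := p1ChartInv a h y with hqdef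
  have hq : q ∈ p1Cell i := hy
  obtain ⟨hs0, hs1⟩ := p1Cell_slab hq
  have hyq : y = p1Chart a h q := (p1Chart_p1ChartInv ha hh y).symm
  -- the reproduction identities in chart coordinates
  have hS : ∀ j : Fin 3, ∑ m : Fin 4, p1Lam a h i m y * p1Vec (p1VertOff (p1Par i.1) i.2 m) j = q j - p1Vec i.1 j := by
    intro j
    have := sum_p1Bary_mul_p1Vec_vertOff (p1Par i.1) i.2 (q - p1Vec i.1) j
    simpa [p1Lam, hqdef] using this
  have h1 : ∑ m : Fin 4, p1Lam a h i m y = 1 := sum_p1Lam_eq_one a h i y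
  -- tent values at the vertices and at `q`
  have htm : ∀ m : Fin 4, p1Tent ((i.1.1 : ℝ) + ((p1VertOff (p1Par i.1) i.2 m).1 : ℝ)) =
      (if Even i.1.1 then 0 else 1) + (if Even i.1.1 then 1 else -1) * ((p1VertOff (p1Par i.1) i.2 m).1 : ℝ) := by
    intro m
    have hm := p1Vec_vertOff_zero_mem (p1Par i.1) i.2 m
    simp only [p1Vec_zero] at hm
    exact p1Tent_int_add_corner i.1.1 hm
  have htq : p1Tent (q 0) = (if Even i.1.1 then 0 else 1) + (if Even i.1.1 then 1 else -1) * (q 0 - i.1.1) :=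
    p1Tent_slab i.1.1 hs0 hs1
  -- the coordinates of `y = T q`
  have hy0 : y 0 = a * (q 1 + q 2 / 2 + p1Tent (q 0) / 2) := by rw [hyq]; rfl
  have hy1 : y 1 = a * √3 / 2 * (q 2 + p1Tent (q 0) / 3) := by rw [hyq]; rfl
  have hy2 : y 2 = q 0 * h := by rw [hyq]; rfl
  -- rewrite the sites through the chart
  have hsite : ∀ m : Fin 4, ∀ j : Fin 3, hcpSite a h (i.1 + p1VertOff (p1Par i.1) i.2 m) j =
      p1Chart a h (p1Vec i.1 + p1Vec (p1VertOff (p1Par i.1) i.2 m)) j := by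
    intro m j; rw [← p1Chart_p1Vec, p1Vec_add]
  simp_rw [hsite]
  have hS0 := hS 0
  have hS1 := hS 1
  have hS2 := hS 2
  simp only [Fin.sum_univ_four, p1Vec_zero, p1Vec_one, p1Vec_two] at hS0 hS1 hS2 h1 ⊢
  fin_cases k
  · simp only [Fin.zero_eta, p1Chart_apply_zero, Pi.add_apply, p1Vec_zero, p1Vec_one, p1Vec_two, htm]
    rw [hy0, htq]
    linear_combination a * hS1 + a / 2 * hS2 + a * (if Even i.1.1 then (1:ℝ) else -1) / 2 * hS0 +
      a * ((i.1.2.1 : ℝ) + (i.1.2.2 : ℝ) / 2 + (if Even i.1.1 then (0:ℝ) else 1) / 2) * h1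
  · simp only [Fin.mk_one, p1Chart_apply_one, Pi.add_apply, p1Vec_zero, p1Vec_two, htm]
    rw [hy1, htq]
    linear_combination a * √3 / 2 * hS2 + a * √3 / 2 * (if Even i.1.1 then (1:ℝ) else -1) / 3 * hS0 +
      a * √3 / 2 * ((i.1.2.2 : ℝ) + (if Even i.1.1 then (0:ℝ) else 1) / 3) * h1
  · simp only [Fin.reduceFinMk, p1Chart_apply_two, Pi.add_apply, p1Vec_zero]
    rw [hy2]
    linear_combination h * hS0 + h * (i.1.1 : ℝ) * h1

/-- Vector form of the reproduction: `Σ_m λ_m(y)·y_m = y`. -/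
theorem sum_p1Lam_smul_hcpSite {a h : ℝ} (ha : a ≠ 0) (hh : h ≠ 0) {i : (ℤ × ℤ × ℤ) × Fin 6} {y : Fin 3 → ℝ}
    (hy : y ∈ p1RealCell a h i) :
    (fun k => ∑ m : Fin 4, p1Lam a h i m y * hcpSite a h (i.1 + p1VertOff (p1Par i.1) i.2 m) k) = y :=
  funext fun k => sum_p1Lam_mul_hcpSite ha hh hy k

/-- **The centred second-moment identity on a cell**: for `y` in the real cell and ANY centre `c`,
`Σ_m λ_m(y)·|y_m − y|² = Σ_m λ_m(y)·|y_m − c|² − |y − c|²` (`|·|² = fpSq`).  With `c` a circumcentre-type point this bounds the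
barycentric second moment about `y` by the squared circumradius, uniformly on the cell. -/
theorem sum_p1Lam_mul_fpSq_sub {a h : ℝ} (ha : a ≠ 0) (hh : h ≠ 0) {i : (ℤ × ℤ × ℤ) × Fin 6} {y : Fin 3 → ℝ}
    (hy : y ∈ p1RealCell a h i) (c : Fin 3 → ℝ) :
    ∑ m : Fin 4, p1Lam a h i m y * fpSq (fun k => hcpSite a h (i.1 + p1VertOff (p1Par i.1) i.2 m) k - y k) =
      (∑ m : Fin 4, p1Lam a h i m y * fpSq (fun k => hcpSite a h (i.1 + p1VertOff (p1Par i.1) i.2 m) k - c k)) -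
        fpSq (fun k => y k - c k) := by
  have h0 := sum_p1Lam_mul_hcpSite ha hh hy 0
  have h1 := sum_p1Lam_mul_hcpSite ha hh hy 1
  have h2 := sum_p1Lam_mul_hcpSite ha hh hy 2
  have hl := sum_p1Lam_eq_one a h i y
  simp only [Fin.sum_univ_four, fpSq] at h0 h1 h2 hl ⊢
  linear_combination (2 * c 0 - 2 * y 0) * h0 + (2 * c 1 - 2 * y 1) * h1 + (2 * c 2 - 2 * y 2) * h2 +
    (y 0 ^ 2 + y 1 ^ 2 + y 2 ^ 2 - c 0 ^ 2 - c 1 ^ 2 - c 2 ^ 2) * hl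

/-- **Uniform bound of the barycentric second moment by a squared "circumradius"**: if the four vertices of the cell lie within
`fpSq`-distance `ρ` of some centre `c`, then `Σ_m λ_m(y)|y_m − y|² ≤ ρ` for every `y` in the cell. -/
theorem sum_p1Lam_mul_fpSq_le {a h : ℝ} (ha : a ≠ 0) (hh : h ≠ 0) {i : (ℤ × ℤ × ℤ) × Fin 6} {y : Fin 3 → ℝ}
    (hy : y ∈ p1RealCell a h i) {c : Fin 3 → ℝ} {ρ : ℝ}
    (hρ : ∀ m : Fin 4, fpSq (fun k => hcpSite a h (i.1 + p1VertOff (p1Par i.1) i.2 m) k - c k) ≤ ρ) :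
    ∑ m : Fin 4, p1Lam a h i m y * fpSq (fun k => hcpSite a h (i.1 + p1VertOff (p1Par i.1) i.2 m) k - y k) ≤ ρ := by
  rw [sum_p1Lam_mul_fpSq_sub ha hh hy c]
  have hl := sum_p1Lam_eq_one a h i y
  have hle : ∑ m : Fin 4, p1Lam a h i m y * fpSq (fun k => hcpSite a h (i.1 + p1VertOff (p1Par i.1) i.2 m) k - c k) ≤
      ∑ m : Fin 4, p1Lam a h i m y * ρ :=
    Finset.sum_le_sum fun m _ => mul_le_mul_of_nonneg_left (hρ m) (p1Lam_nonneg_of_mem hy m)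
  rw [← Finset.sum_mul, hl, one_mul] at hle
  have hsq : 0 ≤ fpSq (fun k => y k - c k) := by unfold fpSq; positivity
  linarith

/-! ## Affine fields are reproduced; `p1Disp` is an interpolant -/

/-- **Affine fields are reproduced by the interpolant**: `p1Field (samples of b₀ + y·A) = b₀ + y·A` on all of `ℝ³` (`p1Disp` convention:
`(y·A)_k = Σ_j y_j A j k`). -/
theorem p1Field_affine {a h : ℝ} (ha : a ≠ 0) (hh : h ≠ 0) (b₀ : Fin 3 → ℝ) (A : Fin 3 → Fin 3 → ℝ) (y : Fin 3 → ℝ) :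
    p1Field a h (fun n k => b₀ k + (hcpSite a h n 0 * A 0 k + hcpSite a h n 1 * A 1 k + hcpSite a h n 2 * A 2 k)) y =
      b₀ + p1AffCLM A y := by
  obtain ⟨i, hy⟩ := exists_p1RealCell a h y
  rw [p1Field_eq_sum_p1Lam _ hy]
  have h0 := sum_p1Lam_mul_hcpSite ha hh hy 0
  have h1 := sum_p1Lam_mul_hcpSite ha hh hy 1
  have h2 := sum_p1Lam_mul_hcpSite ha hh hy 2
  have hl := sum_p1Lam_eq_one a h i y
  simp only [Fin.sum_univ_four] at h0 h1 h2 hl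
  funext k
  simp only [Fin.sum_univ_four, p1CellVals, Pi.add_apply, p1AffCLM_apply]
  linear_combination (b₀ k) * hl + A 0 k * h0 + A 1 k * h1 + A 2 k * h2

/-- The interpolant is additive in the lattice values (pointwise, via the cell formula). -/
theorem p1Field_sub {a h : ℝ} (V V' : ℤ × ℤ × ℤ → (Fin 3 → ℝ)) (y : Fin 3 → ℝ) :
    p1Field a h (fun n => V n - V' n) y = p1Field a h V y - p1Field a h V' y := by
  obtain ⟨i, hy⟩ := exists_p1RealCell a h y
  rw [p1Field_eq_sum_p1Lam _ hy, p1Field_eq_sum_p1Lam _ hy, p1Field_eq_sum_p1Lam _ hy]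
  funext k
  simp only [p1CellVals, Pi.sub_apply, mul_sub, Finset.sum_sub_distrib]

/-- **`p1Disp` IS an interpolant**: `p1Disp a h U b₀ A = p1Field a h (n ↦ p1DispSite a h U b₀ A n)` — the far-ledger field is the P1
interpolant of its own lattice samples `p1DispSite` (linear precision), so every `p1Field`-lemma (vertex quadrature, Jensen,
`tsum_p1SiteBare_le…`) applies to it.  NOT a proof of H12⋆, NOT summit progress. -/
theorem p1Disp_eq_p1Field {a h : ℝ} (ha : a ≠ 0) (hh : h ≠ 0) (U : ℤ × ℤ × ℤ → (Fin 3 → ℝ)) (b₀ : Fin 3 → ℝ)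
    (A : Fin 3 → Fin 3 → ℝ) : p1Disp a h U b₀ A = p1Field a h (fun n k => p1DispSite a h U b₀ A n k) := by
  have hs : (fun n k => p1DispSite a h U b₀ A n k) = fun n => U n -
      (fun k => b₀ k + (hcpSite a h n 0 * A 0 k + hcpSite a h n 1 * A 1 k + hcpSite a h n 2 * A 2 k)) := by
    funext n k
    rw [p1DispSite_apply ha hh]
    rfl
  funext y
  rw [hs, p1Field_sub, p1Field_affine ha hh, p1Disp]

/-- Translated form (the re-based field `ṽ(x) = v(y₀ + x)` of the far inequality): `ṽ = (p1Field of the samples) ∘ (y₀ + ·)`. -/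
theorem p1Disp_translate_eq_p1Field {a h : ℝ} (ha : a ≠ 0) (hh : h ≠ 0) (U : ℤ × ℤ × ℤ → (Fin 3 → ℝ)) (b₀ : Fin 3 → ℝ)
    (A : Fin 3 → Fin 3 → ℝ) (y₀ x : Fin 3 → ℝ) :
    p1Disp a h U b₀ A (y₀ + x) = p1Field a h (fun n k => p1DispSite a h U b₀ A n k) (y₀ + x) := by
  rw [p1Disp_eq_p1Field ha hh]

end Summit.AtomisticToContinuum.Crystallization.Theorems.StrictSplittingRuleBirth
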